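import Summits.HubbardSuperconductivity.HubbardLadder.NeelSignUniformShellSix
import Summits.HubbardSuperconductivity.HubbardLadder.NeelSignC15B2
import HarnessLib

/-!
# The typed conjecture (S) through distance 6 after the cell `(1,5)`, BY NAME: `NeelSignUniformUpTo 6 ↔ cells (0,6), (3,3)` (HubbardLadder R2, lineage B)

HONEST FRAMING: ladder R1–R4 with certified numbers; no claim on H/H₀.  Reference model only (spin-½ Heisenberg antiferromagnet on
even tori); BOOKKEEPING over landed kernel rows in the style of `NeelSignUniformShellSix` — it proves no new inequality and asserts
nothing about Néel order or the Hubbard model.  Inputs: `neelSignUniformUpTo_six_iff` (`NeelSignUniformShellSix`: shell 6 = (0,6) ∧ (1,5) ∧ (3,3))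
and `neelSignCell_1_5` (`NeelSignC15B2`, certificate `B2`).  Pen: r2-eng-2 g15 (staged with the `(1,5)` road; files only after `NeelSignC15B2` is BUILT).
[cite: KLS1988JSP, p. 1021] [cite: DLS1978, Theorem 4.2]
-/

noncomputable section

namespace Summit.HubbardSuperconductivity.HubbardLadder

open Literature.MathematicalPhysics.QuantumLattice Summit.HubbardSuperconductivity.Conjectures

/-! ### Shell 6 of the typed conjecture (S) after `(1,5)`, BY NAME -/

/-- **After the cell `(1,5)`, shell 6 is the two cells `(0,6)`, `(3,3)`**: `NeelSignUniformUpTo 6 ↔ NeelSignCell 0 6 ∧ NeelSignCell 3 3`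
(the tree's `neelSignUniformUpTo_six_iff` with `neelSignCell_1_5` substituted).  BOOKKEEPING ONLY over landed kernel rows — no new inequality.
HONEST FRAMING: ladder R1–R4 with certified numbers; no claim on H/H₀. [cite: KLS1988JSP, p. 1021] -/
theorem neelSignUniformUpTo_six_iff_cells_06_33 :
    NeelSignUniformUpTo 6 ↔ NeelSignCell 0 6 ∧ NeelSignCell 3 3 := by
  rw [neelSignUniformUpTo_six_iff]
  exact ⟨fun h => ⟨h.1, h.2.2⟩, fun h => ⟨h.1, neelSignCell_1_5, h.2⟩⟩

/-- The distance-6 truncation of (S) from its two remaining open cells (converse direction, for assembly).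
HONEST FRAMING: ladder R1–R4 with certified numbers; no claim on H/H₀. [cite: KLS1988JSP, p. 1021] -/
theorem neelSignUniformUpTo_six_of_cells_06_33 (h06 : NeelSignCell 0 6) (h33 : NeelSignCell 3 3) :
    NeelSignUniformUpTo 6 :=
  neelSignUniformUpTo_six_of_cells h06 neelSignCell_1_5 h33

end Summit.HubbardSuperconductivity.HubbardLadder

end
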